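import Mathlib.GroupTheory.Archimedean
import Literature.IUT.HodgeArakelov.GaloisPairRigidity
import Literature.IUT.HodgeArakelov.MonoThetaCyclotomesBridgeEtTh
import Literature.IUT.HodgeTheaters.DiscreteProfiniteCompletionsAssembly
import Literature.IUT.HodgeTheaters.DiscreteProfiniteCompletionsProofs
import Literature.AnabelianGeometry.AbsoluteAnabelian.PadicGaussValuation
import HarnessLib

/-!
# [IUTchII] Rmk 1.11.5 (i): the valuation surjection `H¹(G, μ_Ẑ(G)) ↠ Ẑ` — NON-VACUITY of the interface
# `ValuationSurjection` (NV-L6 wave)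

S. Mochizuki, *Inter-universal Teichmüller theory II*, §1, Remark 1.11.5 (i) (kurims p. 55): "the natural
surjection `H¹(G, μ_Ẑ(G)) ↠ Ẑ` … when `G = G_k`, this surjection is the surjection determined by the valuation
of `k` on the image of the natural Kummer map `k^× ↪ H¹(G_k, μ_Ẑ(G_k))` — where we recall that the image of
this Kummer map is equal to the inverse image of `ℤ ⊆ Ẑ`" [cite: Mochizuki2012, Rmk 1.11.5 (i) p.55]
[claim: Mochizuki2012, status: disputed].

PROOF-ONLY non-vacuity file (abc-iut cell, wave-4 prover abc-iut-w4-d098, L6-lead §F v1.18p row call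
«NV-L6 WAVE»; interface `ValuationSurjection` of abc-iut-L6-t1's `GaloisPairRigidity.lean`).  No `def`,
`instance` or `structure` is declared; every witness is built inside a theorem term.

WHAT IS WITNESSED, HONESTLY.  The interface is parametrised by an [IUTchII] §1 `ThetaSetting S`, whose base
field `S.k` is a BARE characteristic-zero field.  It is NOT inhabited for every `S`: the Kummer field forces
`val ∘ kummer : S.kˣ → Ẑ` to have image exactly `ℤ`, impossible when `S.kˣ` is divisible (e.g. `k`
algebraically closed) — so a witness must use the valuation of `k`.  We prove:

* `ValuationSurjection.nonempty_model_of_valuation` — for ANY setting `S` and any SURJECTIVE ("normalised")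
  valuation `v : S.kˣ →* Multiplicative ℤ`, the interface is inhabited by the model in which `H¹(G, μ_Ẑ(G))`
  is realised through its Kummer description `(k^×)^∧ ≅ 𝒪_k^× × Ẑ` (`ker v × Ẑ`, after the choice of a
  uniformiser `π`, `v π = 1`), `val` = the `Ẑ`-coordinate, and the Kummer map is the canonical dense
  embedding `a ↦ (a·π^{-v(a)}, ι(v a))` (`ι : ℤ → Ẑ` the profinite completion map, injective); the three
  printed properties (surjectivity of `val`, injectivity of the Kummer map, image = `val⁻¹(ℤ)`) are PROVED.
  This is the arithmetic content of Rmk 1.11.5 (i) at `G = G_k` (classical Kummer theory identifies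
  `H¹(G_k, Ẑ(1))` with `(k^×)^∧`; we do not construct continuous cohomology here and say so).
* `ValuationSurjection.nonempty_model_of_unitsHom` — the same from ANY homomorphism `kˣ → ℤ` that does not
  vanish somewhere (normalised by `exists_surjective_unitsHom_of_apply_ne_one`: subgroups of `ℤ` are cyclic).
* `ValuationSurjection.nonempty_model_ofDoubleUnderline` — the GENUINE instantiation: at the [IUTchII] §1
  setting of the Tate curve `ThetaSetting.ofDoubleUnderline` (abc-iut bridge B8 over an [EtTh] §1 theta
  setting; `k := K ⊆ ℚ̄_p` finite over `ℚ_p`) the interface is inhabited, the valuation being the `p`-adic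
  order of `K` (abc-iut-L4's `exists_unitsHom_of_essFiniteType`, nonvanishing at `p`, normalised).
* FUNCTORIALITY: the interface's index category `IsoClass S.Gk` (topological groups isomorphic to `G_k`, with
  isomorphisms) carries no field data, and print asks only that the surjection be "corically defined";
  the witness realises `H¹(−)` as the CONSTANT family with identity transport (`mapH1 := AddEquiv.refl`),
  which is natural.  This part of the witness is therefore TRIVIAL by design — disclosed here and in the
  theorem's docstring; the model is genuine in its arithmetic fields and constant in its functorial ones.

Nothing here takes a side on [IUTchIII] Cor. 3.12; a non-vacuity witness asserts only that the interface is
consistent and met by the printed data of a valued base field.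
-/

noncomputable section

namespace Literature.IUT.HodgeArakelov

open CategoryTheory Literature.IUT.HodgeTheaters

universe u

/-- `ℤ → Ẑ` is injective (`ℤ` is free, hence residually finite; [IUTchI] Thm 2.6 p. 56 "`F ⊆ F̂`").
[cite: Mochizuki2012, Rmk 1.11.5 (i) p.55] -/
theorem toCompletion_int_injective :
    Function.Injective (toCompletion (Multiplicative ℤ)) := by
  haveI : IsFreeGroup (Multiplicative ℤ) := IsFreeGroup.ofMulEquiv (FreeGroup.mulEquivIntOfUnique (α := Unit))
  exact FreeOrSurface.toCompletion_injective (Multiplicative ℤ)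


/-- **[IUTchII] Rmk 1.11.5 (i) — the interface `ValuationSurjection S` is INHABITED for every setting whose
base field carries a surjective (normalised) valuation `v : kˣ ↠ ℤ`.**  Model: `H¹(G, μ_Ẑ(G)) := ker v × Ẑ`
(the Kummer description `(k^×)^∧ ≅ 𝒪_k^× × Ẑ` after choosing a uniformiser `π`), `val :=` the `Ẑ`-coordinate,
Kummer map `a ↦ (a·π^{-v(a)}, ι(v a))`; `val` surjective, Kummer injective, image of Kummer `= val⁻¹(ℤ)` —
all PROVED.  Functoriality over `IsoClass S.Gk` is the CONSTANT family with identity transport (trivially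
natural; the index objects carry no field data) — genuine arithmetic fields, constant functorial fields.
[cite: Mochizuki2012, Rmk 1.11.5 (i) p.55] -/
theorem ValuationSurjection.nonempty_model_of_valuation (S : ThetaSetting.{u})
    (v : S.kˣ →* Multiplicative ℤ) (hv : Function.Surjective v) :
    Nonempty (ValuationSurjection S) := by
  classical
  -- a uniformiser
  obtain ⟨π, hπ⟩ := hv (Multiplicative.ofAdd 1)
  -- `v (π ^ n) = ofAdd n`
  have hvπ : ∀ n : ℤ, v (π ^ n) = Multiplicative.ofAdd n := fun n => by
    rw [map_zpow, hπ, ← ofAdd_zsmul, smul_eq_mul, mul_one]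
  -- the unit part `a ↦ a · π^{-v a}` lands in `ker v`
  have hunit : ∀ a : S.kˣ, a * π ^ (-(Multiplicative.toAdd (v a))) ∈ v.ker := fun a => by
    rw [MonoidHom.mem_ker, map_mul, hvπ]
    exact mul_inv_cancel (v a)
  have hι : Function.Injective (toCompletion (Multiplicative ℤ)) := toCompletion_int_injective
  -- the unit-part homomorphism `kˣ → 𝒪ˣ := ker v`
  let upart : S.kˣ →* v.ker :=
    { toFun := fun a => ⟨a * π ^ (-(Multiplicative.toAdd (v a))), hunit a⟩
      map_one' := by ext; simp
      map_mul' := fun a b => by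
        ext
        simp only [map_mul, toAdd_mul, neg_add, zpow_add, Subgroup.coe_mul]
        rw [mul_mul_mul_comm] }
  have upart_coe : ∀ a : S.kˣ, ((upart a : v.ker) : S.kˣ) = a * π ^ (-(Multiplicative.toAdd (v a))) :=
    fun a => rfl
  -- the model of `H¹(G, μ_Ẑ(G))`: `ker v × Ẑ`, written additively (the SAME group for every `G`)
  -- the Kummer map `a ↦ (a·π^{-v a}, ι (v a))`
  let κ : S.kˣ →* Multiplicative (Additive v.ker × Additive ZHat) :=
    { toFun := fun a =>
        Multiplicative.ofAdd (Additive.ofMul (upart a), Additive.ofMul (toCompletion (Multiplicative ℤ) (v a)))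
      map_one' := by simp only [map_one, ofMul_one]; rfl
      map_mul' := fun a b => by
        rw [← ofAdd_add, Prod.mk_add_mk, ← ofMul_mul, ← ofMul_mul, ← map_mul, ← map_mul, ← map_mul] }
  have κ_apply : ∀ a : S.kˣ, κ a =
      Multiplicative.ofAdd (Additive.ofMul (upart a), Additive.ofMul (toCompletion (Multiplicative ℤ) (v a))) :=
    fun a => rfl
  refine ⟨{ H1 := fun _ => Additive v.ker × Additive ZHat
            grpH1 := fun _ =>
              { (inferInstance : AddGroup (Additive v.ker × Additive ZHat)) with
                add_comm := fun a b => Prod.ext (add_comm a.1 b.1) (ZHat.mul_comm a.2.toMul b.2.toMul) }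
            val := fun _ => AddMonoidHom.snd (Additive v.ker) (Additive ZHat)
            val_surjective := fun _ z => ⟨(0, z), rfl⟩
            mapH1 := fun _ => AddEquiv.refl (Additive v.ker × Additive ZHat)
            mapH1_id := fun _ => rfl
            mapH1_comp := fun _ _ => AddEquiv.ext fun _ => rfl
            val_natural := fun _ _ => rfl
            kummer := κ
            kummer_injective := ?_
            kummer_range := ?_ }⟩
  · -- injectivity: `κ a = κ b` forces `v a = v b` (`ι` injective) and equal unit parts, hence `a = b`
    intro a b hab
    rw [κ_apply, κ_apply] at hab
    have h := Multiplicative.ofAdd.injective hab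
    have h1 : upart a = upart b := Additive.ofMul.injective (congrArg Prod.fst h)
    have h2 : v a = v b := hι (Additive.ofMul.injective (congrArg Prod.snd h))
    have h1' := congrArg (fun u : v.ker => (u : S.kˣ)) h1
    simp only [upart_coe, h2] at h1'
    exact mul_right_cancel h1'
  · -- image of the Kummer map = `val⁻¹(ℤ)`
    intro x
    constructor
    · rintro ⟨a, ha⟩
      refine ⟨Multiplicative.toAdd (v a), ?_⟩
      rw [κ_apply] at ha
      have hx : x = (Additive.ofMul (upart a), Additive.ofMul (toCompletion (Multiplicative ℤ) (v a))) :=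
        (Multiplicative.ofAdd.injective ha).symm
      rw [hx, ofAdd_toAdd]
      rfl
    · rintro ⟨n, hn⟩
      -- `x = (w, ι n)`; take `a := w · πⁿ`
      have hn' : x.2 = Additive.ofMul (toCompletion (Multiplicative ℤ) (Multiplicative.ofAdd n)) := hn
      refine ⟨((Additive.toMul x.1 : v.ker) : S.kˣ) * π ^ n, ?_⟩
      have hva : v (((Additive.toMul x.1 : v.ker) : S.kˣ) * π ^ n) = Multiplicative.ofAdd n := by
        rw [map_mul, (MonoidHom.mem_ker).1 (Additive.toMul x.1 : v.ker).2, one_mul, hvπ]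
      have hup : upart (((Additive.toMul x.1 : v.ker) : S.kˣ) * π ^ n) = Additive.toMul x.1 := by
        ext
        rw [upart_coe, hva, toAdd_ofAdd, mul_assoc, ← zpow_add, add_neg_cancel, zpow_zero, mul_one]
      rw [κ_apply, hup, hva, ofMul_toMul, ← hn']

/-- **Normalisation of a nontrivial valuation.**  A homomorphism `w : A → ℤ` that does not vanish at some
`a` has image `g·ℤ` with `g ≠ 0` (subgroups of `ℤ` are cyclic); dividing by `g` gives a SURJECTIVE
homomorphism `A ↠ ℤ`. [cite: Mochizuki2012, Rmk 1.11.5 (i) p.55] -/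
theorem exists_surjective_unitsHom_of_apply_ne_one {A : Type*} [CommGroup A] (w : A →* Multiplicative ℤ)
    (a : A) (ha : w a ≠ 1) : ∃ v : A →* Multiplicative ℤ, Function.Surjective v := by
  -- the additive image is `g ℤ`
  let w' : Additive A →+ ℤ := MonoidHom.toAdditiveLeft w
  have hw' : ∀ x : A, w' (Additive.ofMul x) = Multiplicative.toAdd (w x) := fun _ => rfl
  obtain ⟨g, hg⟩ := Int.subgroup_cyclic w'.range
  rw [← AddSubgroup.zmultiples_eq_closure] at hg
  have hmem : ∀ x : A, ∃ k : ℤ, k * g = Multiplicative.toAdd (w x) := fun x => by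
    have hx : w' (Additive.ofMul x) ∈ w'.range := ⟨_, rfl⟩
    rw [hg, AddSubgroup.mem_zmultiples_iff] at hx
    simpa [hw'] using hx
  have hg0 : g ≠ 0 := by
    rintro rfl
    obtain ⟨k, hk⟩ := hmem a
    apply ha
    rw [mul_zero] at hk
    exact Multiplicative.toAdd.injective (by simpa using hk.symm)
  have hdvd : ∀ x : A, g ∣ Multiplicative.toAdd (w x) := fun x => by
    obtain ⟨k, hk⟩ := hmem x
    exact ⟨k, by rw [← hk, mul_comm]⟩
  -- `g` itself is a value
  have hgmem : g ∈ w'.range := by rw [hg]; exact AddSubgroup.mem_zmultiples g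
  obtain ⟨x₀, hx₀⟩ := hgmem
  -- the normalised valuation `x ↦ w(x)/g`
  refine ⟨{ toFun := fun x => Multiplicative.ofAdd (Multiplicative.toAdd (w x) / g)
            map_one' := by simp
            map_mul' := fun x y => by
              rw [← ofAdd_add, map_mul, toAdd_mul, Int.add_ediv_of_dvd_left (hdvd x)] }, fun n => ?_⟩
  refine ⟨(Additive.toMul x₀) ^ (Multiplicative.toAdd n), ?_⟩
  simp only [MonoidHom.coe_mk, OneHom.coe_mk, map_zpow]
  have h0 : Multiplicative.toAdd (w (Additive.toMul x₀)) = g := by rw [← hw']; exact hx₀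
  rw [h0, Int.ediv_self hg0, ← ofAdd_zsmul, smul_eq_mul, mul_one, ofAdd_toAdd]

/-- **Non-vacuity from any nontrivial valuation**: if the base field of the setting admits a homomorphism
`kˣ → ℤ` that does not vanish somewhere (e.g. at `p`), the interface `ValuationSurjection S` is inhabited
(normalise, then `nonempty_model_of_valuation`). [cite: Mochizuki2012, Rmk 1.11.5 (i) p.55] -/
theorem ValuationSurjection.nonempty_model_of_unitsHom (S : ThetaSetting.{u})
    (w : S.kˣ →* Multiplicative ℤ) (a : S.kˣ) (ha : w a ≠ 1) : Nonempty (ValuationSurjection S) := by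
  obtain ⟨v, hv⟩ := exists_surjective_unitsHom_of_apply_ne_one w a ha
  exact ValuationSurjection.nonempty_model_of_valuation S v hv

/-- **Non-vacuity at the GENUINE [IUTchII] §1 setting of the Tate curve** (`ThetaSetting.ofDoubleUnderline`,
abc-iut bridge B8: `k := K ⊆ ℚ̄_p`, a finite extension of `ℚ_p`, the base field of an [EtTh] §1 theta setting):
`ValuationSurjection` is inhabited there, the valuation being the `p`-adic order of `K` (a homomorphism
`K^× → ℤ` nonvanishing at `p`, abc-iut-L4's `exists_unitsHom_of_essFiniteType`, normalised).
[cite: Mochizuki2012, Rmk 1.11.5 (i) p.55] -/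
theorem ValuationSurjection.nonempty_model_ofDoubleUnderline {p : ℕ} [Fact p.Prime]
    {D : Literature.AnabelianGeometry.EtaleTheta.ThetaSetting p} {E : D.EtaleThetaData} {l : ℕ}
    (C : E.DoubleUnderline l) {N : ℕ+} (μ : D.CyclotomeMod l N) (hC : D.Compat) (hS : D.Sec2Hyps)
    (hl : l.Prime) (hp2 : p ≠ 2) (hpl : p ≠ l) (hζ : ∃ ζ : D.K, IsPrimitiveRoot ζ (4 * l))
    {η : (C.thetaEnvData μ hC hS).PiYdd → Literature.AnabelianGeometry.EtaleTheta.MuN p N}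
    (hη : η ∈ (C.thetaEnvData μ hC hS).thetaCocycles) :
    Nonempty (ValuationSurjection (ThetaSetting.ofDoubleUnderline C μ hC hS hl hp2 hpl hζ hη)) := by
  have hp : (p : ℕ).Prime := Fact.out
  -- the base field of the setting is `K`, a finite extension of `ℚ_p`
  have hp0 : ((p : ℕ) : D.K) ≠ 0 := Nat.cast_ne_zero.mpr hp.ne_zero
  haveI : FiniteDimensional ℚ_[p] D.K := D.finiteDimensional_K
  obtain ⟨w, hw⟩ :=
    Literature.AnabelianGeometry.AbsoluteAnabelian.exists_unitsHom_of_essFiniteType p (D.K : Type)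
  exact ValuationSurjection.nonempty_model_of_unitsHom _ w (Units.mk0 ((p : ℕ) : D.K) hp0) (hw hp0)

end Literature.IUT.HodgeArakelov

end
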